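import Summits.BirchSwinnertonDyer.BirchSwinnertonDyer.Theorems.SignedLowerHalvesKobayashiLowerHalfSemistablePW21CubeRoots
import Literature.NumberTheory.Automorphic.BrandtIndexReducedNorm
import HarnessLib

/-!
# The mod-`2` Eisenstein criterion in the Brandt module, part 1/2: sub-ideals of index `ℓ²` fixed by a FOURTH root of
# unity (`u² = -1`) are principal — Thue's lemma for `ℤ[i]`, `trd u = 0`, `nrd u = 1`, non-scalar residue at odd `ℓ`

Route-independent `Theorems` file (cell `b2b-bsdres`, seat `b2b-bsdres-x10b` = class owner X6/X7, gen 42); part 5 of the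
series `…PW21CubeRoots` / `…PW21FixedIdeals` / `…DefmuPollackWestonLemma21` (gen 41) / `…PW21NonEisensteinOdd` (gen 42).
HONEST FRAMING: prove what is provable now; shrink each hard class to its core with data; no claim beyond stated
classes. Nothing about any curve is asserted and NO summit statement is proved here; BSD is not proved by any of this.

This is the `ℤ[i]`-twin of parts 1–2 of the series (there: `ℤ[ζ₃]`, `u² + u + 1 = 0`, the prime `3`), needed for the
prime `2`: a class `c` of a Brandt setup with EVEN weight `w_c = |O_L(I_c)ˣ| / 2` carries a unit `u` of order `4`,
`u² = -1`, and the Brandt columns of such a class are `≡ (ℓ + 1) e_c (mod 2)` off the diagonal at every ODD prime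
`ℓ ∤ N⁺N⁻` (part 2/2, `…PW21NonEisensteinTwo.lean`), because **a `u`-fixed sub-ideal of index `ℓ²` is principal**. Here:

* `GaussNorm.exists_sq_add_sq_eq_prime` — THUE's lemma for `m² + n²`: an odd prime `ℓ ∣ a² + 1` is `m² + n²` with
  `ℓ ∣ m + n a` (pigeonhole on `x + a y (mod ℓ)`, `0 ≤ x, y ≤ ⌊√ℓ⌋`; a non-zero `(m, n)` with `ℓ ∣ m² + n² < 2ℓ`).
* `trdZ_nrdZ_of_fourthRoot` — `u² + 1 = 0` in a `ℤ`-order of a quaternion algebra over `ℚ` forces `trd u = 0`,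
  `nrd u = 1` (else `u` would be a rational square root of `-1`).
* `residue_fourthRoot_ne_smul_one` — under a matrix residue map modulo an ODD prime `ℓ`, `ψ u` is not a scalar
  (`u - c̃ ∈ ℓ O` would give `ℓ ∣ 2c̃`, `ℓ² ∣ c̃² + 1`, so `ℓ² ∣ 4`).
* `exists_eigenvalue_of_fourthRoot_fixed` — a `u`-stable sub-ideal `M_L` of index `ℓ²` has `L = ker (ψ u - a)`,
  `a² + 1 = 0`; `exists_eq_units_smul_of_fourthRoot_fixed` — such an `M` is `β O` with `β = m + n u`,
  `nrd β = m² + n² = ℓ` (`u + ã ∈ M` for a lift `ã` of `a`... precisely `u - ã • 1` with `ã` a lift of `-a`, and `ℓ ∈ M`).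

## References

* B. H. Gross, *Heights and the special values of L-series*, CMS Conf. Proc. 7 (1987), §§1–3 [Gross1987].
* M.-F. Vignéras, LNM 800 (1980), Ch. II §2 Thm. 2.3, Ch. III §5 B [VignerasLNM800].
* J. Voight, *Quaternion Algebras*, GTM 288 (2021), (41.1.1), 41.1.3 [Voight2021].
-/

noncomputable section

open scoped Pointwise Matrix TensorProduct

open Literature.NumberTheory.Automorphic

universe u

-- D-0017: single-problem summit, the namespace repeats the problem name by design.
set_option linter.dupNamespace false

namespace Summit.BirchSwinnertonDyer.BirchSwinnertonDyer.Theorems.PollackWestonLemma21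

variable {B : Type u} [Ring B] [Algebra ℚ B] [IsQuaternionAlgebra ℚ B]

/-! ### Thue's lemma for the norm form `m² + n²` of `ℤ[i]` -/

namespace GaussNorm

/-- Core of Thue's argument for `m² + n²`: a non-zero vector `(m, n)` with `ℓ ∣ m + n a`, `ℓ ∣ a² + 1` (so that
`ℓ ∣ m² + n²`) and `m² + n² < 2ℓ` represents `ℓ`. [folklore] -/
private theorem form_eq_prime_of_small {ℓ : ℕ} (hℓ : ℓ.Prime) {a m n : ℤ} (ha : (ℓ : ℤ) ∣ a ^ 2 + 1)
    (hmn : m ≠ 0 ∨ n ≠ 0) (hdvd : (ℓ : ℤ) ∣ m + n * a)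
    (hsmall : m ^ 2 + n ^ 2 < 2 * ℓ) : m ^ 2 + n ^ 2 = ℓ := by
  have hNpos : 0 < m ^ 2 + n ^ 2 := by
    rcases hmn with hm0 | hn0
    · have := sq_pos_of_ne_zero hm0; nlinarith [sq_nonneg n]
    · have := sq_pos_of_ne_zero hn0; nlinarith [sq_nonneg m]
  -- `ℓ ∣ N`
  have hℓN : (ℓ : ℤ) ∣ m ^ 2 + n ^ 2 := by
    have hid : m ^ 2 + n ^ 2 = (m + n * a) * (m - n * a) + n ^ 2 * (a ^ 2 + 1) := by ring
    rw [hid]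
    exact dvd_add (hdvd.mul_right _) (ha.mul_left _)
  obtain ⟨c, hc⟩ := hℓN
  have hℓpos : (0 : ℤ) < ℓ := by exact_mod_cast hℓ.pos
  rw [hc] at hNpos hsmall
  have hc1 : 0 < c := (mul_pos_iff_of_pos_left hℓpos).mp hNpos
  have hc2 : c < 2 := lt_of_mul_lt_mul_left (by linarith) hℓpos.le
  have hc' : c = 1 := by omega
  rw [hc, hc', mul_one]

/-- **Thue's lemma for `ℤ[i]`** (Fermat–Euler): if a prime `ℓ` divides `a² + 1` then `ℓ = m² + n²` with `ℓ ∣ m + n a`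
(the prime `(ℓ, i - a)` of `ℤ[i]` above `ℓ` is principal, generated by `m + n i`): pigeonhole on
`(x, y) ↦ x + a y (mod ℓ)` over `0 ≤ x, y ≤ ⌊√ℓ⌋`, then `form_eq_prime_of_small`. [folklore] -/
theorem exists_sq_add_sq_eq_prime {ℓ : ℕ} (hℓ : ℓ.Prime) {a : ℤ} (ha : (ℓ : ℤ) ∣ a ^ 2 + 1) :
    ∃ m n : ℤ, m ^ 2 + n ^ 2 = ℓ ∧ (ℓ : ℤ) ∣ m + n * a := by
  haveI : Fact ℓ.Prime := ⟨hℓ⟩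
  have hlt : ℓ < (Nat.sqrt ℓ + 1) * (Nat.sqrt ℓ + 1) := Nat.lt_succ_sqrt ℓ
  have hle : Nat.sqrt ℓ * Nat.sqrt ℓ ≤ ℓ := Nat.sqrt_le ℓ
  -- `ℓ` is not a square
  have hss : Nat.sqrt ℓ * Nat.sqrt ℓ ≠ ℓ := by
    intro h
    have hsd : Nat.sqrt ℓ ∣ ℓ := ⟨Nat.sqrt ℓ, h.symm⟩
    rcases (Nat.dvd_prime hℓ).mp hsd with h1 | h1
    · rw [h1, one_mul] at h; exact hℓ.one_lt.ne' h.symm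
    · rw [h1] at h; have := hℓ.one_lt; nlinarith
  have hs2 : ((Nat.sqrt ℓ : ℕ) : ℤ) ^ 2 ≤ (ℓ : ℤ) - 1 := by
    have h1 : ((Nat.sqrt ℓ * Nat.sqrt ℓ : ℕ) : ℤ) ≤ ((ℓ - 1 : ℕ) : ℤ) := by exact_mod_cast (by omega)
    rw [Nat.cast_sub hℓ.one_lt.le] at h1; push_cast at h1; nlinarith
  -- pigeonhole on `(x, y) ↦ x + a y mod ℓ`, `0 ≤ x, y ≤ s`
  let f : Fin (Nat.sqrt ℓ + 1) × Fin (Nat.sqrt ℓ + 1) → ZMod ℓ :=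
    fun xy => ((xy.1 : ℕ) : ℤ) + a * ((xy.2 : ℕ) : ℤ)
  have hcard : Fintype.card (ZMod ℓ) < Fintype.card (Fin (Nat.sqrt ℓ + 1) × Fin (Nat.sqrt ℓ + 1)) := by
    rw [ZMod.card, Fintype.card_prod, Fintype.card_fin]; exact hlt
  obtain ⟨⟨x, y⟩, ⟨x', y'⟩, hne, heq⟩ := Fintype.exists_ne_map_eq_of_card_lt f hcard
  simp only [f] at heq
  have hx : ((x : ℕ) : ℤ) ≤ Nat.sqrt ℓ := by exact_mod_cast Nat.lt_succ_iff.mp x.2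
  have hx' : ((x' : ℕ) : ℤ) ≤ Nat.sqrt ℓ := by exact_mod_cast Nat.lt_succ_iff.mp x'.2
  have hy : ((y : ℕ) : ℤ) ≤ Nat.sqrt ℓ := by exact_mod_cast Nat.lt_succ_iff.mp y.2
  have hy' : ((y' : ℕ) : ℤ) ≤ Nat.sqrt ℓ := by exact_mod_cast Nat.lt_succ_iff.mp y'.2
  have hx0 : (0 : ℤ) ≤ ((x : ℕ) : ℤ) := Nat.cast_nonneg _
  have hx0' : (0 : ℤ) ≤ ((x' : ℕ) : ℤ) := Nat.cast_nonneg _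
  have hy0 : (0 : ℤ) ≤ ((y : ℕ) : ℤ) := Nat.cast_nonneg _
  have hy0' : (0 : ℤ) ≤ ((y' : ℕ) : ℤ) := Nat.cast_nonneg _
  refine ⟨((x : ℕ) : ℤ) - ((x' : ℕ) : ℤ), ((y : ℕ) : ℤ) - ((y' : ℕ) : ℤ),
    form_eq_prime_of_small hℓ ha ?_ ?_ ?_, ?_⟩
  · -- `(m, n) ≠ (0, 0)`
    by_contra h
    rw [not_or, not_not, not_not] at h
    apply hne
    have h1 : (x : ℕ) = x' := by exact_mod_cast sub_eq_zero.mp h.1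
    have h2 : (y : ℕ) = y' := by exact_mod_cast sub_eq_zero.mp h.2
    rw [Prod.mk.injEq]; exact ⟨Fin.ext h1, Fin.ext h2⟩
  · rw [← ZMod.intCast_zmod_eq_zero_iff_dvd]
    push_cast at heq ⊢
    linear_combination heq
  · have hmb : (((x : ℕ) : ℤ) - ((x' : ℕ) : ℤ)) ^ 2 ≤ ((Nat.sqrt ℓ : ℕ) : ℤ) ^ 2 :=
      sq_le_sq' (by linarith) (by linarith)
    have hnb : (((y : ℕ) : ℤ) - ((y' : ℕ) : ℤ)) ^ 2 ≤ ((Nat.sqrt ℓ : ℕ) : ℤ) ^ 2 :=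
      sq_le_sq' (by linarith) (by linarith)
    nlinarith
  · rw [← ZMod.intCast_zmod_eq_zero_iff_dvd]
    push_cast at heq ⊢
    linear_combination heq

end GaussNorm

/-! ### Fourth roots of unity in an order: `trd u = 0`, `nrd u = 1` -/

/-- **A fourth root of unity `u` (`u² + 1 = 0`) in a `ℤ`-order of a quaternion algebra over `ℚ` has reduced trace `0`
and reduced norm `1`**: from `u² = t u - n` (`t, n ∈ ℤ`) we get `t u = (n - 1) · 1`; if `t ≠ 0` then `u` would be the
rational scalar `(n-1)/t`, a root of `x² + 1` in `ℚ`; so `t = 0` and then `n = 1`. [folklore] -/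
theorem trdZ_nrdZ_of_fourthRoot {O : Submodule ℤ B} (hO : IsZOrder O) {u : B} (hu : u ∈ O)
    (hfour : u * u + 1 = 0) : trdZ u = 0 ∧ nrdZ u = 1 := by
  haveI : Nontrivial B := Module.nontrivial_of_finrank_pos (R := ℚ)
    (by rw [IsQuaternionAlgebra.finrank_eq_four (K := ℚ) (D := B)]; norm_num)
  have h1 : (1 : B) ≠ 0 := one_ne_zero
  have hkey : (trdZ u : ℤ) • u = (nrdZ u - 1 : ℤ) • (1 : B) := by
    have h := hO.mul_self_eq_trdZ hu
    have h' : u * u = -1 := by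
      rw [← sub_eq_zero, sub_neg_eq_add]; exact hfour
    have h2 : (trdZ u : ℤ) • u - (nrdZ u : ℤ) • (1 : B) = -1 := h.symm.trans h'
    rw [sub_smul, one_smul]
    calc (trdZ u : ℤ) • u = ((trdZ u : ℤ) • u - (nrdZ u : ℤ) • (1 : B)) + (nrdZ u : ℤ) • 1 := by abel
      _ = -1 + (nrdZ u : ℤ) • 1 := by rw [h2]
      _ = (nrdZ u : ℤ) • 1 - 1 := by abel
  have hkeyQ : ((trdZ u : ℤ) : ℚ) • u = ((nrdZ u - 1 : ℤ) : ℚ) • (1 : B) := by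
    rw [Int.cast_smul_eq_zsmul, Int.cast_smul_eq_zsmul]; exact hkey
  by_cases ht : trdZ u = 0
  · refine ⟨ht, ?_⟩
    rw [ht, Int.cast_zero, zero_smul] at hkeyQ
    have h3 := (smul_eq_zero.mp hkeyQ.symm).resolve_right h1
    have : (nrdZ u - 1 : ℤ) = 0 := by exact_mod_cast h3
    linarith
  · exfalso
    set q : ℚ := (nrdZ u - 1 : ℤ) / (trdZ u : ℤ) with hq
    have htq : ((trdZ u : ℤ) : ℚ) ≠ 0 := by exact_mod_cast ht
    have hu' : u = q • (1 : B) := by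
      have h3 : u = ((trdZ u : ℤ) : ℚ)⁻¹ • (((trdZ u : ℤ) : ℚ) • u) := by
        rw [smul_smul, inv_mul_cancel₀ htq, one_smul]
      rw [h3, hkeyQ, smul_smul, hq, div_eq_inv_mul]
    have h4 : (q ^ 2 + 1) • (1 : B) = 0 := by
      have : u * u + 1 = (q ^ 2 + 1) • (1 : B) := by
        rw [hu', smul_mul_smul_comm, mul_one, add_smul, one_smul, sq]
      rw [← this, hfour]
    have hq0 : q ^ 2 + 1 = 0 := (smul_eq_zero.mp h4).resolve_right h1
    nlinarith [sq_nonneg q]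

/-! ### The residue of a fourth root of unity at an odd prime is not a scalar -/

/-- **The image of a fourth root of unity `u ∈ O` (`u² + 1 = 0`) under a matrix residue map modulo an ODD prime `ℓ` is
not a scalar matrix.** If `ψ u = c · 1`, then `u - c̃ = ℓ y` with `y ∈ O` for a lift `c̃ ∈ ℤ` of `c`; reduced traces and
norms give `ℓ ∣ 2c̃` and `ℓ² ∣ c̃² + 1`, whence `ℓ² ∣ 4(c̃² + 1) - (2c̃)² = 4`, i.e. `ℓ = 2`. [folklore] -/
theorem residue_fourthRoot_ne_smul_one {O : Submodule ℤ B} (hO : IsZOrder O) {ℓ : ℕ}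
    [Fact ℓ.Prime] (hℓ2 : ℓ ≠ 2) {ψ : B → Matrix (Fin 2) (Fin 2) (ZMod ℓ)} (h : IsMatrixResidueMap O ℓ ψ)
    {u : B} (hu : u ∈ O) (hfour : u * u + 1 = 0) (c : ZMod ℓ) :
    ψ u ≠ c • (1 : Matrix (Fin 2) (Fin 2) (ZMod ℓ)) := by
  intro hc
  have hℓ : ℓ.Prime := Fact.out
  set c' : ℤ := ((c.val : ℕ) : ℤ) with hc'
  have hcc : ((c' : ℤ) : ZMod ℓ) = c := by rw [hc', Int.cast_natCast, ZMod.natCast_zmod_val]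
  have h1O : (1 : B) ∈ O := hO.one_mem
  have hx : u - c' • (1 : B) ∈ O := O.sub_mem hu (O.smul_mem _ h1O)
  have hψ : ψ (u - c' • (1 : B)) = 0 := by
    rw [h.map_sub hu (O.smul_mem _ h1O), h.map_zsmul h1O, h.map_one, hc, ← Int.cast_smul_eq_zsmul (ZMod ℓ),
      hcc, sub_self]
  obtain ⟨y, hy, hyeq⟩ := (h.ker _ hx).mp hψ
  obtain ⟨ht, hn⟩ := trdZ_nrdZ_of_fourthRoot hO hu hfour
  have hneg : u - c' • (1 : B) = u + (-c') • (1 : B) := by rw [neg_smul, sub_eq_add_neg]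
  have hsm : (-c') • (1 : B) ∈ O := O.smul_mem _ h1O
  -- reduced trace: `-2 c' = ℓ · trd y`
  have htr : trdZ (u - c' • (1 : B)) = -2 * c' := by
    rw [hneg, hO.trdZ_add hu hsm, hO.trdZ_zsmul _ h1O, IsZOrder.trdZ_one, ht]; ring
  have htr' : trdZ (u - c' • (1 : B)) = ℓ * trdZ y := by rw [hyeq, hO.trdZ_zsmul _ hy]
  -- reduced norm: `c'² + 1 = ℓ² · nrd y`
  have hmul1 : u * ((-c') • (1 : B)) = (-c') • u := by rw [mul_smul_comm, mul_one]
  have hnr : nrdZ (u - c' • (1 : B)) = c' ^ 2 + 1 := by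
    rw [hneg, hO.nrdZ_add hu hsm, hO.nrdZ_zsmul _ h1O, IsZOrder.nrdZ_one, hn, IsZOrder.polZ,
      hO.trdZ_zsmul _ h1O, IsZOrder.trdZ_one, ht, hmul1, hO.trdZ_zsmul _ hu, ht]
    ring
  have hnr' : nrdZ (u - c' • (1 : B)) = (ℓ : ℤ) ^ 2 * nrdZ y := by rw [hyeq, hO.nrdZ_zsmul _ hy]
  have hd1 : (ℓ : ℤ) ∣ 2 * c' := ⟨-trdZ y, by linarith⟩
  have hd2 : (ℓ : ℤ) ^ 2 ∣ c' ^ 2 + 1 := ⟨nrdZ y, by linarith⟩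
  have hd3 : (ℓ : ℤ) ^ 2 ∣ (2 * c') ^ 2 := pow_dvd_pow_of_dvd hd1 2
  have hd4 : (ℓ : ℤ) ^ 2 ∣ 4 := by
    have := dvd_sub (hd2.mul_left 4) hd3
    have hid : 4 * (c' ^ 2 + 1) - (2 * c') ^ 2 = 4 := by ring
    rwa [hid] at this
  have hle : (ℓ : ℤ) ^ 2 ≤ 4 := Int.le_of_dvd (by norm_num) hd4
  have h3 : (3 : ℤ) ≤ ℓ := by
    have h2 := hℓ.two_le
    have : 3 ≤ ℓ := by omega
    exact_mod_cast this
  nlinarith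

/-! ### Sub-ideals of index `ℓ²` fixed by a fourth root of unity are principal -/

/-- **Step 1 (eigenline).** Let `M = M_L ⊆ O` be the sub-ideal of index `ℓ²` (`ℓ` odd) attached to the line `L ⊆ 𝔽_ℓ²` by
the residue map `ψ`, and suppose `u M ⊆ M` for `u ∈ O` with `u² + 1 = 0`. Then `L` is an eigenline of `g = ψ u`:
there is `a ∈ 𝔽_ℓ` with `a² + 1 = 0` and `L = ker (g - a)`, the full `a`-eigenspace (a line because `g` is not a
scalar). [folklore] -/
theorem exists_eigenvalue_of_fourthRoot_fixed {O : Submodule ℤ B} (hO : IsZOrder O) {ℓ : ℕ} [Fact ℓ.Prime]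
    (hℓ2 : ℓ ≠ 2) {ψ : B → Matrix (Fin 2) (Fin 2) (ZMod ℓ)}
    (h : IsMatrixResidueMap O ℓ ψ) {u : B} (hu : u ∈ O) (hfour : u * u + 1 = 0)
    {M : Submodule ℤ B} (hMO : M ≤ O) (hmul : ∀ m ∈ M, ∀ a ∈ O, m * a ∈ M)
    (hidx : M.toAddSubgroup.relIndex O.toAddSubgroup = ℓ ^ 2) (hfix : ∀ m ∈ M, u * m ∈ M) :
    ∃ a : ZMod ℓ, a ^ 2 + 1 = 0 ∧
      M = h.idealOf (LinearMap.ker (Matrix.toLin' (ψ u) - a • LinearMap.id)) := by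
  have hℓ : ℓ.Prime := Fact.out
  obtain ⟨hL1, hML⟩ := h.finrank_eq_one_and_eq_idealOf hO hℓ (ZMod.card ℓ) hMO hmul hidx
  set J := h.imageOf hMO hmul with hJ
  set L := MatrixRightIdeal.colSpan J with hLdef
  set g := ψ u with hg
  -- `g² + 1 = 0`
  have hg2 : g * g + 1 = 0 := by
    have h1 : ψ (u * u + 1) = g * g + 1 := by
      rw [h.map_add _ (hO.mul_mem u hu u hu) 1 hO.one_mem, h.map_mul u hu u hu, h.map_one]
    rw [← h1, hfour, h.map_zero]
  -- a spanning vector `v₀` of the line `L`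
  obtain ⟨v, hv0, hvspan⟩ := (finrank_eq_one_iff' (K := ZMod ℓ)).mp hL1
  set v₀ : Fin 2 → ZMod ℓ := (v : Fin 2 → ZMod ℓ) with hv₀
  have hv₀L : v₀ ∈ L := v.2
  have hv₀0 : v₀ ≠ 0 := fun h0 => hv0 (Subtype.ext h0)
  -- `g v₀ ∈ L`
  have hgv : g *ᵥ v₀ ∈ L := by
    have hA : Matrix.vecMulVec v₀ (Pi.single 0 1) ∈ J :=
      MatrixRightIdeal.vecMulVec_mem_of_mem_colSpan hv₀L _
    obtain ⟨m₀, hm₀, hm₀A⟩ := (h.mem_imageOf_iff hMO hmul).mp hA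
    have hum : ψ (u * m₀) ∈ J := (h.mem_imageOf_iff hMO hmul).mpr ⟨u * m₀, hfix m₀ hm₀, rfl⟩
    rw [h.map_mul u hu m₀ (hMO hm₀), hm₀A] at hum
    have := MatrixRightIdeal.mulVec_mem_colSpan hum (Pi.single 0 1)
    rwa [← Matrix.mulVec_mulVec, Matrix.vecMulVec_mulVec, dotProduct_single_one, Pi.single_eq_same,
      MulOpposite.op_one, one_smul] at this
  obtain ⟨a, ha⟩ := hvspan ⟨g *ᵥ v₀, hgv⟩
  have hgv₀ : g *ᵥ v₀ = a • v₀ := by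
    have := congrArg Subtype.val ha
    simpa [hv₀] using this.symm
  -- `a² + 1 = 0`
  have ha2 : a ^ 2 + 1 = 0 := by
    have h1 : (g * g + 1) *ᵥ v₀ = (a ^ 2 + 1) • v₀ := by
      rw [Matrix.add_mulVec, Matrix.one_mulVec, ← Matrix.mulVec_mulVec, hgv₀,
        Matrix.mulVec_smul, hgv₀, smul_smul, add_smul, one_smul, sq]
    rw [hg2, Matrix.zero_mulVec] at h1
    exact (smul_eq_zero.mp h1.symm).resolve_right hv₀0
  refine ⟨a, ha2, ?_⟩
  -- `L ≤ E_a = ker (g - a)` and `E_a ≠ ⊤` (`g` is not a scalar), so `L = E_a`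
  set E : Submodule (ZMod ℓ) (Fin 2 → ZMod ℓ) := LinearMap.ker (Matrix.toLin' g - a • LinearMap.id)
    with hE
  have hmemE : ∀ w, w ∈ E ↔ g *ᵥ w = a • w := fun w => by
    rw [hE, LinearMap.mem_ker, LinearMap.sub_apply, LinearMap.smul_apply, LinearMap.id_apply,
      Matrix.toLin'_apply, sub_eq_zero]
  have hLE : L ≤ E := by
    intro w hw
    obtain ⟨c, hc⟩ := hvspan ⟨w, hw⟩
    have hw' : w = c • v₀ := by
      have := congrArg Subtype.val hc; simpa [hv₀] using this.symm
    rw [hmemE, hw', Matrix.mulVec_smul, hgv₀, smul_smul, smul_smul, mul_comm]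
  have hEtop : E ≠ ⊤ := by
    intro htop
    apply residue_fourthRoot_ne_smul_one hO hℓ2 h hu hfour a
    refine MatrixRightIdeal.eq_of_forall_mulVec_eq fun w => ?_
    have hw : w ∈ E := htop ▸ Submodule.mem_top
    rw [(hmemE w).mp hw, Matrix.smul_mulVec, Matrix.one_mulVec]
  have hEfin : Module.finrank (ZMod ℓ) E ≤ 1 := by
    have hlt : Module.finrank (ZMod ℓ) E < Module.finrank (ZMod ℓ) (⊤ : Submodule (ZMod ℓ) (Fin 2 → ZMod ℓ)) :=
      Submodule.finrank_lt_finrank_of_lt (lt_top_iff_ne_top.mpr hEtop)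
    rw [finrank_top, Module.finrank_fin_fun] at hlt
    omega
  have hLE' : L = E := Submodule.eq_of_le_of_finrank_le hLE (hL1 ▸ hEfin)
  rw [hML]
  change h.idealOf L = h.idealOf E
  rw [hLE']

/-- **Step 2 (principal generator). A right sub-`O`-module `M ⊆ O` of index `ℓ²` (`ℓ` odd) with `u M ⊆ M` for a fourth
root of unity `u ∈ O` is principal: `M = β O` with `β = m + n u ∈ ℤ[u]` of reduced norm `ℓ`.** By Step 1, `M = M_{E_a}`
for a root `a` of `x² + 1` in `𝔽_ℓ`; the element `u - a'` (`a' = -a` the other root, lifted to `ℤ`) lies in `M_{E_a}`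
since `(g - a)(g - a') = 0`, and so does `ℓ`; Thue's lemma gives `β = m + n u ∈ (u - a', ℓ) ⊆ M` with
`nrd β = m² + n² = ℓ`, so `[O : β O] = ℓ² = [O : M]` and `M = β O`. [folklore] -/
theorem exists_eq_units_smul_of_fourthRoot_fixed (hdef : IsTotallyDefinite ℚ B)
    {O : Submodule ℤ B} (hO : IsZOrder O) {ℓ : ℕ} [Fact ℓ.Prime] (hℓ2 : ℓ ≠ 2)
    {ψ : B → Matrix (Fin 2) (Fin 2) (ZMod ℓ)} (h : IsMatrixResidueMap O ℓ ψ) {u : B} (hu : u ∈ O)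
    (hfour : u * u + 1 = 0) {M : Submodule ℤ B} (hMO : M ≤ O)
    (hmul : ∀ m ∈ M, ∀ a ∈ O, m * a ∈ M) (hidx : M.toAddSubgroup.relIndex O.toAddSubgroup = ℓ ^ 2)
    (hfix : ∀ m ∈ M, u * m ∈ M) : ∃ β : Bˣ, (β : B) ∈ O ∧ M = β • O := by
  have hℓ : ℓ.Prime := Fact.out
  obtain ⟨a, ha2, hME⟩ := exists_eigenvalue_of_fourthRoot_fixed hO hℓ2 h hu hfour hMO hmul hidx hfix
  set g := ψ u with hg
  have h1O : (1 : B) ∈ O := hO.one_mem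
  have hg2 : g * g + 1 = 0 := by
    have h1 : ψ (u * u + 1) = g * g + 1 := by
      rw [h.map_add _ (hO.mul_mem u hu u hu) 1 h1O, h.map_mul u hu u hu, h.map_one]
    rw [← h1, hfour, h.map_zero]
  have hmemE : ∀ w, w ∈ LinearMap.ker (Matrix.toLin' g - a • LinearMap.id) ↔ g *ᵥ w = a • w :=
    fun w => by
      rw [LinearMap.mem_ker, LinearMap.sub_apply, LinearMap.smul_apply, LinearMap.id_apply,
        Matrix.toLin'_apply, sub_eq_zero]
  -- the other root `a' = -a`, lifted to `ã ∈ ℤ`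
  set ã : ℤ := (((-a : ZMod ℓ).val : ℕ) : ℤ) with hãdef
  have hã : ((ã : ℤ) : ZMod ℓ) = -a := by rw [hãdef, Int.cast_natCast, ZMod.natCast_zmod_val]
  have haa : a * (-a) = 1 := by linear_combination (-1 : ZMod ℓ) * ha2
  have hℓdvd : (ℓ : ℤ) ∣ ã ^ 2 + 1 := by
    rw [← ZMod.intCast_zmod_eq_zero_iff_dvd]; push_cast; rw [hã]; linear_combination ha2
  -- `u - ã • 1 ∈ M` and `ℓ • 1 ∈ M`
  have hℓ1M : (ℓ : ℤ) • (1 : B) ∈ M := by rw [hME]; exact h.smul_mem_preim _ h1O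
  have hmem1 : u - ã • (1 : B) ∈ M := by
    rw [hME]
    refine ⟨O.sub_mem hu (O.smul_mem _ h1O), ?_⟩
    rw [Submodule.mem_toAddSubgroup, MatrixRightIdeal.mem_rightIdealOf_iff]
    intro w
    rw [hmemE]
    have hψ : ψ (u - ã • (1 : B)) = g - (-a) • (1 : Matrix (Fin 2) (Fin 2) (ZMod ℓ)) := by
      rw [h.map_sub hu (O.smul_mem _ h1O), h.map_zsmul h1O, h.map_one,
        ← Int.cast_smul_eq_zsmul (ZMod ℓ), hã]
    have hgg : g * g = -1 := by rw [← sub_eq_zero, sub_neg_eq_add]; exact hg2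
    rw [hψ, Matrix.sub_mulVec, Matrix.smul_mulVec, Matrix.one_mulVec, Matrix.mulVec_sub,
      Matrix.mulVec_smul, Matrix.mulVec_mulVec, hgg, Matrix.neg_mulVec, Matrix.one_mulVec,
      smul_sub, smul_smul, haa, one_smul]
    module
  -- Thue: `β = m + n u` with `nrd β = ℓ`, `β ∈ M`
  obtain ⟨m, n, hmn, hdvd⟩ := GaussNorm.exists_sq_add_sq_eq_prime hℓ hℓdvd
  obtain ⟨k, hk⟩ := hdvd
  set β : B := (m : ℤ) • (1 : B) + (n : ℤ) • u with hβ
  have hβO : β ∈ O := O.add_mem (O.smul_mem _ h1O) (O.smul_mem _ hu)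
  have hβM : β ∈ M := by
    have : β = (n : ℤ) • (u - ã • (1 : B)) + k • ((ℓ : ℤ) • (1 : B)) := by
      rw [hβ, smul_sub, smul_smul, smul_smul, show k * (ℓ : ℤ) = m + n * ã by rw [mul_comm]; exact hk.symm]
      module
    rw [this]
    exact M.add_mem (M.smul_mem _ hmem1) (M.smul_mem _ hℓ1M)
  obtain ⟨htu, hnu⟩ := trdZ_nrdZ_of_fourthRoot hO hu hfour
  have hnβ : nrdZ β = ℓ := by
    have hmul1 : ((m : ℤ) • (1 : B)) * ((n : ℤ) • u) = (m * n : ℤ) • u := by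
      rw [smul_mul_assoc, one_mul, smul_smul]
    rw [hβ, hO.nrdZ_add (O.smul_mem _ h1O) (O.smul_mem _ hu), hO.nrdZ_zsmul _ h1O,
      hO.nrdZ_zsmul _ hu, IsZOrder.nrdZ_one, hnu, IsZOrder.polZ, hO.trdZ_zsmul _ h1O, hO.trdZ_zsmul _ hu,
      IsZOrder.trdZ_one, htu, hmul1, hO.trdZ_zsmul _ hu, htu, ← hmn]
    ring
  have hβ0 : β ≠ 0 := by
    intro h0
    rw [h0, IsZOrder.nrdZ_zero] at hnβ
    exact hℓ.ne_zero (by exact_mod_cast hnβ.symm)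
  obtain ⟨βu, hβu⟩ := isUnit_of_isTotallyDefinite B hdef hβ0
  -- `βu • O ⊆ M`, both of index `ℓ²` in `O`
  have hle : βu • O ≤ M := by
    intro x hx
    rw [mem_units_smul_submodule_iff] at hx
    have hx' : x = β * (((βu⁻¹ : Bˣ) : B) * x) := by
      rw [← hβu, ← mul_assoc, Units.mul_inv, one_mul]
    rw [hx']
    exact hmul β hβM _ hx
  have hβleft : (βu : B) ∈ Brandt.leftOrder O := fun y hy => by rw [hβu]; exact hO.mul_mem β hβO y hy
  have hidxβ : (βu • O).toAddSubgroup.relIndex O.toAddSubgroup = ℓ ^ 2 :=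
    (Brandt.relIndex_units_smul_eq_sq_iff hdef hO.isFullLattice hβleft ℓ).mpr
      (by rw [hβu, ← hO.cast_nrdZ hβO, hnβ]; norm_cast)
  have hmulidx := AddSubgroup.relIndex_mul_relIndex (H := (βu • O).toAddSubgroup)
    (K := M.toAddSubgroup) (L := O.toAddSubgroup) hle hMO
  rw [hidx, hidxβ] at hmulidx
  have h1 : (βu • O).toAddSubgroup.relIndex M.toAddSubgroup = 1 :=
    Nat.eq_of_mul_eq_mul_right (pow_pos hℓ.pos 2) (by rw [hmulidx, one_mul])
  exact ⟨βu, hβu ▸ hβO, le_antisymm (fun x hx => (AddSubgroup.relIndex_eq_one.mp h1) hx) hle⟩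

end Summit.BirchSwinnertonDyer.BirchSwinnertonDyer.Theorems.PollackWestonLemma21

end
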